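import Literature.NumberTheory.ConnesConsani2021.ScalingOperator
import Literature.Analysis.Convolution.DixmierMalliavinHolds
import HarnessLib

/-!
# `ϑ(g)` for a Weil test function is a finite sum of products `ϑ(f_r) ϑ(ψ_r)` of two such operators
# (Dixmier–Malliavin on `ℝ` + `ϑ(f ⋆ ψ) = ϑ(f) ϑ(ψ)`)

LABEL (line 1): RH-FREE literature (theorems only; NO definition, NO named fact).  bears_on: LADDER-RH
W-C/W-P (C1 named-fact debt), cell `rh-crit`, sub-cell cc, overflow row O1 — glue for the "annulus road" under
`Connes1999_thm_VII_4_rat`: the Hilbert–Schmidt × Hilbert–Schmidt structure of the annulus pieces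
`ϑ(g) Q …` comes from splitting `ϑ(g) = Σ_r ϑ(f_r) ϑ(ψ_r)` (`AnnulusMainTermHS`).  WHAT THIS IS NOT: any claim
about positivity, Weil's criterion or RH.

Sources.  J. Dixmier, P. Malliavin, Bull. Sci. Math. 102 (1978) 305–330, §3 Thm. 3.1 [`DixmierMalliavin1978`]
(PROVED in the tree: `Literature.Analysis.Convolution.DixmierMalliavin_real_holds`); A. Connes, C. Consani,
Selecta Math. 27 (2021) [`ConnesConsani2021`], App. A eq. (77) / Cor. 2.3 (i) (`ϑ(f ⋆ g) = ϑ(f)ϑ(g)`, tree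
`scalingOp_weilConv`).

## What is proved

* `scalingOp_add`, `scalingOp_finset_sum` — additivity of `g ↦ ϑ(g)` on integrable `g`;
* **`exists_scalingOp_eq_sum_comp`** — for `g` smooth with compact support there are `N` and smooth compactly
  supported `f_r, ψ_r` (`r < N`) with `ϑ(g) = Σ_r ϑ(f_r) ∘ ϑ(ψ_r)`.

No instance, notation or attribute; no `def`.
-/

noncomputable section

open _root_.MeasureTheory Complex Set Filter
open scoped Real Topology ComplexConjugate InnerProductSpace ContDiff Convolution

namespace Literature.NumberTheory.Connes2026

open Literature.NumberTheory.LFunctions Literature.Analysis.OperatorTheory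
open Literature.NumberTheory.ConnesConsani2021
open Literature.Analysis.Convolution

/-- `ϑ(g + h) = ϑ(g) + ϑ(h)` for integrable `g, h`. [cite: ConnesConsani2021, Prop. 2.2 (iii) p. 10 (proof: `ϑ(f) = ∫ f(λ)ϑ(λ)d*λ` is linear in `f`)] -/
theorem scalingOp_add {g h : ℝ → ℂ} (hg : Integrable g) (hh : Integrable h) :
    scalingOp (g + h) = scalingOp g + scalingOp h := by
  refine ContinuousLinearMap.ext fun η => ?_
  rw [add_apply, scalingOp_apply (hg.add hh), scalingOp_apply hg, scalingOp_apply hh,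
    ← integral_add (integrable_smul_scalingUnitary hg η) (integrable_smul_scalingUnitary hh η)]
  refine integral_congr_ae (Eventually.of_forall fun τ => ?_)
  simp only [Pi.add_apply, add_smul]

/-- `ϑ(0) = 0`. [cite: ConnesConsani2021, Prop. 2.2 (iii) p. 10 (proof)] -/
theorem scalingOp_zero_fun : scalingOp (0 : ℝ → ℂ) = 0 := by
  refine ContinuousLinearMap.ext fun η => ?_
  rw [scalingOp_apply (integrable_zero ℝ ℂ volume), zero_apply]
  simp

/-- `ϑ(Σ_{r ∈ s} g_r) = Σ_{r ∈ s} ϑ(g_r)` for integrable `g_r`. [cite: ConnesConsani2021, Prop. 2.2 (iii) p. 10 (proof)] -/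
theorem scalingOp_finset_sum {ι : Type*} (s : Finset ι) {g : ι → ℝ → ℂ} (hg : ∀ r ∈ s, Integrable (g r)) :
    scalingOp (∑ r ∈ s, g r) = ∑ r ∈ s, scalingOp (g r) := by
  classical
  induction s using Finset.induction_on with
  | empty => simp [scalingOp_zero_fun]
  | insert a s ha ih =>
    rw [Finset.sum_insert ha, Finset.sum_insert ha,
      scalingOp_add (hg a (Finset.mem_insert_self a s))
        (integrable_finsetSum' s fun r hr => hg r (Finset.mem_insert_of_mem hr)),
      ih fun r hr => hg r (Finset.mem_insert_of_mem hr)]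

/-- **`ϑ(g) = Σ_r ϑ(f_r) ϑ(ψ_r)` with smooth compactly supported `f_r, ψ_r`**, for every smooth compactly
supported `g` (Dixmier–Malliavin `g = Σ_r f_r ⋆ ψ_r`, and `ϑ(f ⋆ ψ) = ϑ(f) ϑ(ψ)`). [cite: DixmierMalliavin1978, §3 Thm. 3.1; ConnesConsani2021, App. A eq. (77) p. 30] -/
theorem exists_scalingOp_eq_sum_comp {g : ℝ → ℂ} (hg : ContDiff ℝ ∞ g) (hgs : HasCompactSupport g) :
    ∃ (N : ℕ) (f ψ : Fin N → ℝ → ℂ),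
      (∀ r, ContDiff ℝ ∞ (f r) ∧ HasCompactSupport (f r)) ∧
      (∀ r, ContDiff ℝ ∞ (ψ r) ∧ HasCompactSupport (ψ r)) ∧
      scalingOp g = ∑ r, scalingOp (f r) ∘L scalingOp (ψ r) := by
  obtain ⟨N, f, ψ, hf, hψ, hsum⟩ := exists_eq_sum_convolution_of_contDiff_of_hasCompactSupport hg hgs
  refine ⟨N, f, ψ, hf, hψ, ?_⟩
  have hfi : ∀ r, Integrable (f r) := fun r => (hf r).1.continuous.integrable_of_hasCompactSupport (hf r).2
  have hψi : ∀ r, Integrable (ψ r) := fun r => (hψ r).1.continuous.integrable_of_hasCompactSupport (hψ r).2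
  have hconv : ∀ r, Integrable (weilConv (f r) (ψ r)) := fun r => by
    have h := contDiff_and_hasCompactSupport_convolution (hf r).1 (hf r).2 (hψ r).1 (hψ r).2
    exact h.1.continuous.integrable_of_hasCompactSupport h.2
  have hg' : g = ∑ r, weilConv (f r) (ψ r) := by
    rw [hsum]
    rfl
  rw [hg', scalingOp_finset_sum Finset.univ fun r _ => hconv r]
  exact Finset.sum_congr rfl fun r _ => scalingOp_weilConv (hfi r) (hψi r)

end Literature.NumberTheory.Connes2026
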